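import Literature.AnabelianGeometry.AbsoluteAnabelian.AbsCuspCohomologyKerProofs
import Literature.AnabelianGeometry.AbsoluteAnabelian.AbsTopIII.CurveModelSchemaWitnesses
import Literature.AnabelianGeometry.AbsoluteAnabelian.MLFGaloisTypeProofs
import HarnessLib

/-!
# [AbsCusp] Prop. 2.1 (ii), exactness clause (`AbsCusp.Prop_2_1_ii_ker`, `AbsCusp.Prop_2_1_ii_model`;
# FACT-LIST F-0042, F-0043): INSTANCE FORMS

S. Mochizuki, *Absolute anabelian cuspidalizations of proper hyperbolic curves*, J. Math. Kyoto Univ. **47**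
(2007), Prop. 2.1 (ii) p. 36 of the held copy (`paper:doi-10-1215-kjm-1250281022`): "restricting cohomology
classes of `Π_{U_S}` to the various `I_x[U_S]`, for `x ∈ S`, yields a natural exact sequence
`1 → (k^×)^∧ → H¹(Π_{U_S}, M_X) → ⊕_{x∈S} Ẑ†`".  Cell abc-iut, block F, seat abc-iut-f-053 (gen 4), KEY row
INST59H3.  PROOF-ONLY companion of `AbsCuspCohomology.lean` (abc-iut-L4-t16; imported via abc-iut-f-054's
`AbsCuspCohomologyKerProofs`, never edited; no definition, no instance).

THE ROWS.  `Prop_2_1_ii_ker r q I` (typed via inflation–restriction: a class of `H¹(Π_{U_S}, M_X)` vanishes on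
every `I_x` iff it vanishes on `Δ_{U_S}`) is a PREDICATE on a presentation `r : Π_{U_S} → Π_{U_x}`,
`q : Π_{U_x} → Π_X` and a family `I : S → Subgroup Π_{U_S}`; `Prop_2_1_ii_model M` is its (M)-form over the
`CurveModel` interface.  abc-iut-F-lit's kernel census (`plan/LF-KERNEL-STATUS.tsv` col. 14) holds the closure
refuters (abc-iut-f-054 `not_forall_prop_2_1_ii_ker`, `not_forall_prop_2_1_ii_model`: a junk presentation with
CENTRAL cuspidal kernel) and CONDITIONAL closers only (`prop_2_1_ii_ker_of_exists_eq_geom`,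
`prop_2_1_ii_ker_of_oneCusp`; `prop_2_1_ii_model_of_prop_1_4_i'_of_oneCusp`).  This file states instance forms
with conclusion HEAD the row and 0 hypotheses:

* `AbsCusp.prop_2_1_ii_ker_geomFamily r q` — over EVERY presentation `(r, q)`: for the one-member family
  `I := Δ_{U_S}` the predicate holds (both sides of the `iff` coincide; f-054's degenerate criterion
  `prop_2_1_ii_ker_of_exists_eq_geom`).  DEGENERATE: `Δ` itself as "the inertia group of the one cusp".
* `AbsCusp.prop_2_1_ii_ker_toyModel k H` — AT THE NAMED TOY INTERFACE of abc-iut-f-076 (`toyExt k H`: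
  `Π := G_k × H ↠ G_k`; presentation `r = q :=` "kill the `H`-factor" `toyKill k H`; the single cusp `topCusps`
  with `D = Π`, so `I = D ∩ Δ = Δ = {1} × H`): the predicate holds for the toy cusp's inertia family — again
  because that inertia group IS `Δ`.
* `AbsCusp.prop_2_1_ii_model_toyModel k H` — the (M)-form F-0043 HOLDS at `CurveModelSchemaWitness.toyModel k H`
  (one curve, all presentations `U_S = U_x = X = U` with `res = toyKill`), for every `k`, `H`, outright.
* NON-VACUITY at `(k, H) = (ℚ_2, Ẑ)`: `AbsCusp.prop_2_1_ii_model_toyModel_binders` — every hypothesis binder of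
  the (M)-form is inhabited there: `U` is "scheme-like" (`True`), the single cusp IS a cyclotome presentation
  (abc-iut-f-076 `isCyclotomePresentation_toyModel_zHat`: `I ≅ Ẑ`, cuspidal kernel = closed normal closure of
  `I`, cuspidally central extension), `ℚ_2` is an MLF (`isMLF_padic`), and the cusp is rational
  (`isRational_topCusps`).  So the toy instance is not a vacuous certificate.

HONEST LABEL: every instance here is DEGENERATE (the inertia family contains `Δ` itself, which makes the
exactness clause tautological) — statements about OUR typing; the arithmetic content of Prop. 2.1 (ii)
(`H¹(Δ_X, M_X)^{G_k} = 0`, a weight argument over an MLF) is neither used nor claimed; at the intended (étale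
`π₁`) instance the rows stay NAMED INPUTS.  Refuted-as-schema ≠ refuted-in-print; typed ≠ proved; nothing here
bears on the disputed [IUTchIII] Cor. 3.12; no side taken.
-/

noncomputable section

open CategoryTheory
open scoped Pointwise

namespace Literature.AnabelianGeometry.AbsoluteAnabelian

namespace AbsCusp

open AbsTopIII AbsTopIII.CurveModelSchemaWitness

universe u

/-! ### F-0042 over every presentation: the family `{Δ_{U_S}}` -/

/-- **F-0042, INSTANCE FORM over every presentation** `r : Π_{U_S} → Π_{U_x}`, `q : Π_{U_x} → Π_X`
(DEGENERATE): for the one-member family `I := Δ_{U_S}`, `Prop_2_1_ii_ker r q I` holds — "vanishes on every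
member" and "vanishes on `Δ_{U_S}`" are the same clause (f-054's `prop_2_1_ii_ker_of_exists_eq_geom`).
[cite: MochizukiAbsCusp2007, Prop 2.1 (ii) p.36] -/
theorem prop_2_1_ii_ker_geomFamily {E' E F : FundamentalExtension.{u}} (r : E' ⟶ E) (q : E ⟶ F) :
    Literature.AnabelianGeometry.AbsoluteAnabelian.AbsCusp.Prop_2_1_ii_ker r q
      (fun _ : PUnit.{u + 1} => E'.geom) :=
  prop_2_1_ii_ker_of_exists_eq_geom r q _ (fun _ => le_rfl) ⟨PUnit.unit, rfl⟩

/-! ### F-0042 / F-0043 at the named toy interface `toyModel k H` -/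

variable (k : Type) [Field k] [CharZero k] (H : ProfiniteGrp.{0})

/-- **F-0042 AT THE NAMED TOY INTERFACE** (`toyExt k H`: `Π := G_k × H ↠ G_k`, presentation
`r = q := toyKill k H`, the single cusp `topCusps` with `D = Π`, `I = Δ = {1} × H`): `Prop_2_1_ii_ker` holds for
the inertia family of the toy cusp, since that inertia group IS `Δ` (`Icusp_topCusps`).  DEGENERATE toy
instance. [cite: MochizukiAbsCusp2007, Prop 2.1 (ii) p.36] -/
theorem prop_2_1_ii_ker_toyModel :
    Literature.AnabelianGeometry.AbsoluteAnabelian.AbsCusp.Prop_2_1_ii_ker (toyKill k H) (toyKill k H)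
      (fun c : (topCusps (toyExt k H)).Cusp => (topCusps (toyExt k H)).Icusp c) :=
  prop_2_1_ii_ker_of_exists_eq_geom _ _ _ (fun c => (topCusps (toyExt k H)).Icusp_le_geom c)
    ⟨PUnit.unit, Icusp_topCusps (toyExt k H) PUnit.unit⟩

/-- **F-0043 AT THE NAMED TOY INTERFACE `CurveModelSchemaWitness.toyModel k H`** (one curve `U` over `k`,
`Π := G_k × H ↠ G_k`, one cusp with `D = Π`, `res := toyKill`): the (M)-form `Prop_2_1_ii_model` HOLDS — for
every presentation `U_S = U_x = X = U` of the toy model the conclusion is `prop_2_1_ii_ker_toyModel`, whatever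
the hypotheses.  DEGENERATE toy instance (for `(k, H) = (ℚ_2, Ẑ)` every hypothesis binder is inhabited:
`prop_2_1_ii_model_toyModel_binders`); the printed Prop. 2.1 (ii) is untouched.
[cite: MochizukiAbsCusp2007, Prop 2.1 (ii) p.36] -/
theorem prop_2_1_ii_model_toyModel :
    Literature.AnabelianGeometry.AbsoluteAnabelian.AbsCusp.Prop_2_1_ii_model (toyModel k H) :=
  fun _ _ _ _ _ _ _ _ _ _ => prop_2_1_ii_ker_toyModel k H

/-! ### Non-vacuity of the toy instance at `(k, H) = (ℚ_2, Ẑ)` -/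

/-- **The hypothesis binders of `Prop_2_1_ii_model (toyModel ℚ_2 Ẑ)` are all inhabited** at the presentation
`U ⊆ U ⊆ U` and the single cusp: `U` is scheme-like, the cusp IS a cyclotome presentation of `U ⊆ U`
(abc-iut-f-076 `isCyclotomePresentation_toyModel_zHat`: rational, `I ≅ Ẑ`, cuspidal kernel `= Δ =` closed
normal closure of `I`, cuspidally central), the base `ℚ_2` is an MLF (`isMLF_padic`), and every cusp of `U` is
rational (`isRational_topCusps`).  Hence `prop_2_1_ii_model_toyModel ℚ_[2] ZHat` is NOT a vacuous certificate.
[cite: MochizukiAbsCusp2007, Prop 2.1 (ii) p.36] -/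
theorem prop_2_1_ii_model_toyModel_binders :
    (toyModel ℚ_[2] ZHat).IsScheme PUnit.unit ∧
      (toyModel ℚ_[2] ZHat).IsCyclotomePresentation (Ux := PUnit.unit) (X := PUnit.unit) trivial PUnit.unit ∧
        IsMLF ((toyModel ℚ_[2] ZHat).base PUnit.unit) ∧
          (∀ c : ((toyModel ℚ_[2] ZHat).cusps PUnit.unit).Cusp,
            ((toyModel ℚ_[2] ZHat).cusps PUnit.unit).IsRational c) ∧
            Literature.AnabelianGeometry.AbsoluteAnabelian.AbsCusp.Prop_2_1_ii_model (toyModel ℚ_[2] ZHat) :=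
  ⟨trivial, isCyclotomePresentation_toyModel_zHat ℚ_[2] PUnit.unit, isMLF_padic 2,
    fun c => isRational_topCusps _ c, prop_2_1_ii_model_toyModel ℚ_[2] ZHat⟩

end AbsCusp

end Literature.AnabelianGeometry.AbsoluteAnabelian

end
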